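import Literature.NumberTheory.Rogawski1990.UnitOrbitalIntegralInertValueThetaZeroComplete
import Literature.NumberTheory.Automorphic.UnitaryThreeTorusBlockElements
import HarnessLib

/-!
# The `θ̄ = 0` value with the frame data CONSTRUCTED: `#Fix_{U⧸K}(t(a,b,c)) = φ₀(N₁, N₂, N)` from `LocalConjDatum` data alone
(Flicker (1998), *Elementary proof of the fundamental lemma for a unitary group*, Prop. 14 p. 94; Prop. 6 p. 83)

Topic `NumberTheory/Rogawski1990` (road «D-N7-inert», MAP v3 LAYER C → (F12) value stub `X₁`); namespace `Literature.NumberTheory.Automorphic.UnitaryGroup`.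
THEOREMS ONLY; kernel lane.  Pen F0P3b-p01 (g6) (p04 (g12) 06:36:56Z «YOURS», layer (ii-a)).  HONEST LABEL: HC_CM is proved only modulo the 2 remaining named inputs
(hLiu418, h413) until rung 0 closes.

`natCard_fixedPoints_unitaryInt_corner_eq_phiZero`: ★ `natCard_fixedPoints_unitaryInt_flickerTorusOne_eq_phiZero` with the auxiliary frame data BUILT from the local datum:
`c = diag(1,−1,1)` (★ `exists_coe_eq_block_of_rel`), the level elements `η_m` (★ `exists_coe_eq_flickerU`), the radial family in `Z(c)` (★ `exists_diagRadial`),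
`t ∈ Z(c)` (★ `mem_centralizer_of_coe_eq_block`), and B-p12's integer frame at `R := 𝒪[K]` (`ι = subtype`, `σR = σ|_𝒪`, `dR := σa₀ − a₀`, `ϖR := ⟨ϖ, _⟩` irreducible by
★ `maximalIdeal_integer_eq_span`).  What the (F12) consumer still supplies at `K = L_w`: `hJ`, `hd`, `hσO`, `y` (`yσy = −2`), `#k = q²`, an element `a₀` with `σa₀ − a₀`
a unit, the literal `t`, the four orders, the type datum, `hfin`.

## References
* [Flicker1998UnitaryFL] Y. Z. Flicker, *Elementary proof of the fundamental lemma for a unitary group*, Canad. J. Math. 50 (1998), 74–98.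
* [Rogawski1990] J. D. Rogawski, *Automorphic Representations of Unitary Groups in Three Variables* (1990), §4.9 p. 55.
-/

set_option autoImplicit false

open scoped MatrixGroups WithZero Valued
open Matrix

namespace Literature.NumberTheory.Automorphic

namespace UnitaryGroup

open Literature.NumberTheory.Automorphic.HermitianLattice (unitaryInt mem_unitaryInt_iff LocalConjDatum)
open Literature.NumberTheory.Rogawski1990.Flicker1998 (phiZero)
open IsLocalRing

variable {K : Type*} [Field K] [Valued K ℤᵐ⁰] {ϖ : K} (σ : K →+* K) {J : Matrix (Fin 3) (Fin 3) K}

section Corner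

variable [IsDiscreteValuationRing 𝒪[K]] [Finite (ResidueField 𝒪[K])] [IsAdicComplete (maximalIdeal 𝒪[K]) 𝒪[K]]

set_option synthInstance.maxHeartbeats 200000 in
-- the `H`-action on `H ⧸ (K^{u_m} ∩ H)` (as in ★ (F2))
/-- **`#Fix_{U⧸K}(t(a,b,c)) = φ₀(N₁,N₂,N)` from the local datum alone** (frame elements constructed). [cite: Flicker1998UnitaryFL, Prop. 14 p. 94; Prop. 6 p. 83] -/
theorem natCard_fixedPoints_unitaryInt_corner_eq_phiZero (hJ : J = (StdForm.antidiagonal 3).over K) (hd : LocalConjDatum σ ϖ)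
    (hσO : ∀ y : 𝒪[K], (σ.comp 𝒪[K].subtype) y ∈ 𝒪[K]) {y : K} (hy : y * σ y = -2)
    {q : ℕ} (hq : Nat.card (ResidueField 𝒪[K]) = q ^ 2)
    {a₀ : 𝒪[K]} (ha₀ : IsUnit (((σ.comp 𝒪[K].subtype).codRestrict 𝒪[K] hσO) a₀ - a₀))
    {e a b cc : K} (h2e : 2 * e = 1) (ha : σ a * a = 1) (hb : σ b * b = 1) (hcc : σ cc * cc = 1)
    {t : ↥(unitaryGroupOfForm σ J)}
    (hte : ((t : GL (Fin 3) K) : Matrix (Fin 3) (Fin 3) K) = !![e * (a + cc), 0, -(e * (a - cc)); 0, b, 0; -(e * (a - cc)), 0, e * (a + cc)])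
    {N Np N₁ N₂ : ℕ} (hN : Valued.v (a - cc) = Valued.v (ϖ ^ N)) (hNp : Valued.v (a + cc - 2 * b) = Valued.v (ϖ ^ Np))
    (hN₁ : Valued.v (a - b) = Valued.v (ϖ ^ N₁)) (hN₂ : Valued.v (cc - b) = Valued.v (ϖ ^ N₂))
    (h : (N₁ < N ∧ N₂ = N₁ ∧ Np = N₁) ∨ (N ≤ N₁ ∧ N ≤ Np))
    (hfin : {x : ↥(unitaryGroupOfForm σ J) ⧸ unitaryInt σ J | t • x = x}.Finite) :
    (Nat.card {x : ↥(unitaryGroupOfForm σ J) ⧸ unitaryInt σ J | t • x = x} : ℚ) = phiZero q N₁ N₂ N := by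
  classical
  have hϖ0 : ϖ ≠ 0 := hd.ϖ_ne_zero
  -- `c = diag(1, −1, 1)`
  obtain ⟨c, hc⟩ := exists_coe_eq_block_of_rel σ hJ (α := 1) (β := 0) (γ := 0) (δ := 1) (e := -1)
    (by rw [map_one, map_zero]; ring) (by rw [map_one, map_zero]; ring) (by rw [map_zero, map_one]; ring) (by rw [map_zero, map_one]; ring)
    (by rw [map_neg, map_one]; ring)
  have htH : t ∈ Subgroup.centralizer ({c} : Set ↥(unitaryGroupOfForm σ J)) := mem_centralizer_of_coe_eq_block σ hc hte
  -- the level elements `η_m` and the radial family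
  have hu := fun m => exists_coe_eq_flickerU σ hJ hd hy m
  choose u hum using hu
  obtain ⟨r, hr⟩ := exists_diagRadial σ hJ hd.σϖ hϖ0 hc
  -- B-p12's integer frame at `R := 𝒪[K]`
  set σO : 𝒪[K] →+* 𝒪[K] := (σ.comp 𝒪[K].subtype).codRestrict 𝒪[K] hσO with hσOdef
  have hσOσO : ∀ z, σO (σO z) = z := fun z => Subtype.ext (hd.σσ (z : K))
  have hιv : ∀ x : K, Valued.v x ≤ 1 ↔ x ∈ Set.range (𝒪[K].subtype) :=
    fun x => ⟨fun hx => ⟨⟨x, hx⟩, rfl⟩, by rintro ⟨z, rfl⟩; exact z.2⟩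
  have hσι : ∀ z : 𝒪[K], 𝒪[K].subtype (σO z) = σ (𝒪[K].subtype z) := fun z => rfl
  have hdRσ : σO (σO a₀ - a₀) = -(σO a₀ - a₀) := by rw [map_sub, hσOσO]; ring
  have h2O : IsUnit (2 : 𝒪[K]) :=
    (Valuation.Integers.isUnit_iff_valuation_eq_one (Valuation.integer.integers _)).2 (by rw [map_ofNat]; exact hd.v2)
  have hϖle : Valued.v ϖ ≤ 1 := by rw [hd.vϖ, ← WithZero.exp_zero]; exact WithZero.exp_le_exp.2 (by norm_num)
  have hp : Irreducible (⟨ϖ, hϖle⟩ : 𝒪[K]) := (IsDiscreteValuationRing.irreducible_iff_uniformizer _).2 (maximalIdeal_integer_eq_span hd.vϖ)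
  exact natCard_fixedPoints_unitaryInt_flickerTorusOne_eq_phiZero σ hJ hd hσO hy hc u hum 𝒪[K].subtype Subtype.val_injective hιv σO hσOσO hσι
    hdRσ ha₀ h2O hp rfl hq hq ha₀ h2e ha hb hcc hte htH r hr hN hNp hN₁ hN₂ h hfin

end Corner

end UnitaryGroup

end Literature.NumberTheory.Automorphic
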